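import Mathlib
import Summits.Ventures.PercRepro2.Defs
import Summits.Ventures.PercRepro2.Independence
import Summits.Ventures.PercRepro2.Harris
import Summits.Ventures.PercRepro2.Graph
import Summits.Ventures.PercRepro2.Events
import Summits.Ventures.PercRepro2.PartitionThree
import Summits.Ventures.PercRepro2.ZCTwoEdge
import Summits.Ventures.PercRepro2.ZCTwoEdgeGraph
import Summits.Ventures.PercRepro2.ZCA3TwoEdgeGraph
import Summits.Ventures.PercRepro2.ZCRootW

/-!
# Theorem F on the graph (MINE-A.md §70.7): (ZC) when the root `a₁` has degree two with neighbours
`a₃` and a non-mark `w`, from (ZC) on `G − a₁` for the marks `(w, a₃, o)`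
(blind cell PercRepro2, mine-a g24)

`ends : E → Sym2 V`, `f₁ = a₁a₃`, `f₂ = a₁w` the only edges at the root `a₁`; `{a₁} ∉ 𝓔`.  With
`ω⁻ := ω[f₁, f₂ ↦ closed]` the structural lemmas of `ZCTwoEdgeGraph` (Theorem A) apply with `w` in
the place of `o`: `{a₁ ↔ a₃} = {f₁} ∪ ({f₂} ∩ {a₃ ↔ w}⁻)`, `C(a₁) = {a₁} ∪ (C⁻(a₃) if f₁) ∪ (C⁻(w) if f₂)`;
and `{a₁ ↔ o} = ({f₁} ∩ {a₃ ↔ o}⁻) ∪ ({f₂} ∩ {w ↔ o}⁻)`, `{a₃ ↔ o} = {a₃ ↔ o}⁻ ∪ ({a₁ ↔ a₃} ∩ {a₁ ↔ o})`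
(`C(a₃) = C(a₁)` on `{a₁ ↔ a₃}`, `C⁻(a₃)` off it).  The abstract theorem `zc_rootw` applies with
`A = {a₃ ↔ o}⁻`, `W = {a₃ ↔ w}⁻`, `Γ = {w ↔ o}⁻`, `YK = {{a₁} ∪ C⁻(a₃) ∈ 𝓔}`, `YW = {{a₁} ∪ C⁻(w) ∈ 𝓔}`,
`YB = {{a₁} ∪ C⁻(a₃) ∪ C⁻(w) ∈ 𝓔}`; lemma (P1) for `(w, a₃, o)` in `G − a₁` is `partitionThree_lattice`
under `p[f₁, f₂ ↦ 0]`, and the inductive hypothesis is literally (ZC) under `p[f₁, f₂ ↦ 0]` for the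
marks `(w, a₃, o)` (the root moves to `w`) and the up-set `{S ∣ insert a₁ S ∈ 𝓔}`.

**Theorem** (`zc_rootw_graph`): (ZC)_{p[f₁,f₂↦0]}(w, a₃, o; 𝓔′) ≥ 0 ⇒ (ZC)_p(a₁, a₃, o; 𝓔) ≥ 0 — the
root passes to its non-mark neighbour `w`.  One seat.
-/

namespace Summit.Ventures.PercRepro2

section GraphTheoremF

variable {V : Type*} {E : Type*} [Fintype E] [DecidableEq E] {R : Type*} [CommRing R]
  [LinearOrder R] [IsStrictOrderedRing R]

/-- **Theorem F on the graph (MINE-A.md §70.7).**  Bond percolation on a finite graph `(V, E, ends)`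
whose root `a₁` is joined to the rest only by `f₁ = a₁a₃` and `f₂ = a₁w`; `𝓔` an up-set of vertex sets
with `{a₁} ∉ 𝓔`.  If (ZC) holds under `p[f₁, f₂ ↦ 0]` (the graph `G − a₁`) for the marks `(w, a₃, o)`
and the up-set `{S ∣ insert a₁ S ∈ 𝓔}`, then (ZC) holds under `p` for the marks `(a₁, a₃, o)` and `𝓔`. -/
theorem zc_rootw_graph {p : E → R} (hp : IsProbVec p) {ends : E → Sym2 V} {a₁ a₃ o w : V}
    {f₁ f₂ : E} (hf : f₁ ≠ f₂) (hends₁ : ends f₁ = s(a₁, a₃)) (hends₂ : ends f₂ = s(a₁, w))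
    (hroot : ∀ e, a₁ ∈ ends e → e = f₁ ∨ e = f₂) (h13 : a₁ ≠ a₃) (h1o : a₁ ≠ o)
    {𝓔 : Set (Set V)} (h𝓔 : IsUpperSet 𝓔) (h𝓔₁ : ({a₁} : Set V) ∉ 𝓔)
    (hZ : let p' := Function.update (Function.update p f₁ 0) f₂ 0
      let 𝓔' : Set (Set V) := {S | insert a₁ S ∈ 𝓔}
      let e' := connEvent ends w a₃
      let L' := connEvent ends w o
      let U' := clusterInEvent ends w 𝓔'
      let γ' := connEvent ends a₃ o
      0 ≤ prob p' (e'ᶜ ∩ L'ᶜ ∩ γ'ᶜ) * (prob p' (U' ∩ (e' ∩ L')) - prob p' U' * prob p' (e' ∩ L'))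
        - prob p' (e'ᶜ ∩ L'ᶜ ∩ γ') * (prob p' (U' ∩ (e' ∩ L'ᶜ)) - prob p' U' * prob p' (e' ∩ L'ᶜ))) :
    let e := connEvent ends a₁ a₃
    let L := connEvent ends a₁ o
    let U := clusterInEvent ends a₁ 𝓔
    let γ := connEvent ends a₃ o
    0 ≤ prob p (eᶜ ∩ Lᶜ ∩ γᶜ) * (prob p (U ∩ (e ∩ L)) - prob p U * prob p (e ∩ L))
      - prob p (eᶜ ∩ Lᶜ ∩ γ) * (prob p (U ∩ (e ∩ Lᶜ)) - prob p U * prob p (e ∩ Lᶜ)) := by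
  intro e L U γ
  simp only at hZ
  rw [connEvent_comm ends w a₃] at hZ
  -- the events of `G − a₁`
  set A : Set (Config E) := {ω | Conn ends (Function.update (Function.update ω f₁ false) f₂ false) a₃ o} with hAdef
  set W : Set (Config E) := {ω | Conn ends (Function.update (Function.update ω f₁ false) f₂ false) a₃ w} with hWdef
  set Γ : Set (Config E) := {ω | Conn ends (Function.update (Function.update ω f₁ false) f₂ false) w o} with hΓdef
  set YK : Set (Config E) := {ω | {a₁} ∪ cluster ends (Function.update (Function.update ω f₁ false) f₂ false) a₃ ∈ 𝓔} with hYKdef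
  set YW : Set (Config E) := {ω | {a₁} ∪ cluster ends (Function.update (Function.update ω f₁ false) f₂ false) w ∈ 𝓔} with hYWdef
  set YB : Set (Config E) := {ω | {a₁} ∪ cluster ends (Function.update (Function.update ω f₁ false) f₂ false) a₃
      ∪ cluster ends (Function.update (Function.update ω f₁ false) f₂ false) w ∈ 𝓔} with hYBdef
  -- the four graph events in the abstract form
  have he : e = openEdge f₁ ∪ (openEdge f₂ ∩ W) := by
    ext ω
    simp only [e, W, Set.mem_union, Set.mem_inter_iff, Set.mem_setOf_eq, mem_connEvent,
      mem_openEdge]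
    exact conn_root_a3_iff hf hends₁ hends₂ hroot h13 ω
  have hL' : ∀ ω : Config E, Conn ends ω a₁ o ↔ (ω f₁ = true ∧ ω ∈ A) ∨ (ω f₂ = true ∧ ω ∈ Γ) := by
    intro ω
    have h := cluster_root_eq hf hends₁ hends₂ hroot ω
    have ho : o ∈ cluster ends ω a₁ ↔ Conn ends ω a₁ o := Iff.rfl
    rw [← ho, h]
    simp only [A, Γ, Set.mem_union, Set.mem_singleton_iff, Set.mem_setOf_eq, mem_cluster]
    constructor
    · rintro ((h | h) | h)
      · exact absurd h.symm h1o
      · exact Or.inl h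
      · exact Or.inr h
    · rintro (h | h)
      · exact Or.inl (Or.inr h)
      · exact Or.inr h
  have hL : L = (openEdge f₁ ∩ A) ∪ (openEdge f₂ ∩ Γ) := by
    ext ω
    simp only [L, Set.mem_union, Set.mem_inter_iff, mem_connEvent, mem_openEdge]
    exact hL' ω
  have hγ : γ = A ∪ (e ∩ L) := by
    ext ω
    simp only [γ, A, e, L, Set.mem_union, Set.mem_inter_iff, Set.mem_setOf_eq, mem_connEvent]
    constructor
    · intro hc
      by_cases h3 : Conn ends ω a₁ a₃
      · exact Or.inr ⟨h3, conn_trans h3 hc⟩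
      · left
        have := cluster_eq_closeTwo_of_not_conn hf hends₁ hends₂ hroot h13 h3
        have ho : o ∈ cluster ends ω a₃ := hc
        rw [this] at ho
        exact ho
    · rintro (h | ⟨h3, hc⟩)
      · exact conn_mono (closeTwo_le f₁ f₂ ω) h
      · exact conn_trans (conn_symm h3) hc
  have hU : U = (openEdge f₁ ∩ closedEdge f₂ ∩ YK) ∪ (closedEdge f₁ ∩ openEdge f₂ ∩ YW)
      ∪ (openEdge f₁ ∩ openEdge f₂ ∩ YB) := by
    ext ω
    simp only [U, YK, YW, YB, Set.mem_union, Set.mem_inter_iff, Set.mem_setOf_eq,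
      mem_clusterInEvent, mem_openEdge, mem_closedEdge]
    rw [cluster_root_eq hf hends₁ hends₂ hroot ω]
    rcases Bool.eq_false_or_eq_true (ω f₁) with hf1 | hf1 <;>
      rcases Bool.eq_false_or_eq_true (ω f₂) with hf2 | hf2 <;>
      simp [hf1, hf2, h𝓔₁] <;> rfl
  -- the hypotheses of the abstract theorem: invariance under forcing `f₁`, `f₂`
  have hA : ∀ (ω : Config E) (b₁ b₂ : Bool),
      Function.update (Function.update ω f₁ b₁) f₂ b₂ ∈ A ↔ ω ∈ A := by
    intro ω b₁ b₂; simp only [A, Set.mem_setOf_eq, closeTwo_update]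
  have hW : ∀ (ω : Config E) (b₁ b₂ : Bool),
      Function.update (Function.update ω f₁ b₁) f₂ b₂ ∈ W ↔ ω ∈ W := by
    intro ω b₁ b₂; simp only [W, Set.mem_setOf_eq, closeTwo_update]
  have hΓ : ∀ (ω : Config E) (b₁ b₂ : Bool),
      Function.update (Function.update ω f₁ b₁) f₂ b₂ ∈ Γ ↔ ω ∈ Γ := by
    intro ω b₁ b₂; simp only [Γ, Set.mem_setOf_eq, closeTwo_update]
  have hYK : ∀ (ω : Config E) (b₁ b₂ : Bool),
      Function.update (Function.update ω f₁ b₁) f₂ b₂ ∈ YK ↔ ω ∈ YK := by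
    intro ω b₁ b₂; simp only [YK, Set.mem_setOf_eq, closeTwo_update]
  have hYW : ∀ (ω : Config E) (b₁ b₂ : Bool),
      Function.update (Function.update ω f₁ b₁) f₂ b₂ ∈ YW ↔ ω ∈ YW := by
    intro ω b₁ b₂; simp only [YW, Set.mem_setOf_eq, closeTwo_update]
  have hYB : ∀ (ω : Config E) (b₁ b₂ : Bool),
      Function.update (Function.update ω f₁ b₁) f₂ b₂ ∈ YB ↔ ω ∈ YB := by
    intro ω b₁ b₂; simp only [YB, Set.mem_setOf_eq, closeTwo_update]
  -- increasing
  have hAup : IsUpperSet A := fun ω ω' hle hω => conn_mono (closeTwo_mono f₁ f₂ hle) hω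
  have hWup : IsUpperSet W := fun ω ω' hle hω => conn_mono (closeTwo_mono f₁ f₂ hle) hω
  have hΓup : IsUpperSet Γ := fun ω ω' hle hω => conn_mono (closeTwo_mono f₁ f₂ hle) hω
  have hYKup : IsUpperSet YK := fun ω ω' hle hω =>
    h𝓔 (Set.union_subset_union_right _ (cluster_mono (closeTwo_mono f₁ f₂ hle) a₃)) hω
  have hYWup : IsUpperSet YW := fun ω ω' hle hω =>
    h𝓔 (Set.union_subset_union_right _ (cluster_mono (closeTwo_mono f₁ f₂ hle) w)) hω
  have hYBup : IsUpperSet YB := fun ω ω' hle hω =>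
    h𝓔 (Set.union_subset_union (Set.union_subset_union_right _
      (cluster_mono (closeTwo_mono f₁ f₂ hle) a₃)) (cluster_mono (closeTwo_mono f₁ f₂ hle) w)) hω
  -- transitivity in `G − a₁`
  have hWΓ : ∀ ω, ω ∈ W → ω ∈ Γ → ω ∈ A := fun ω hw hγ => conn_trans hw hγ
  have hAW : ∀ ω, ω ∈ A → ω ∈ W → ω ∈ Γ := fun ω ha hw => conn_trans (conn_symm hw) ha
  have hAΓ : ∀ ω, ω ∈ A → ω ∈ Γ → ω ∈ W := fun ω ha hγ => conn_trans ha (conn_symm hγ)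
  -- the cluster events
  have hKB : YK ⊆ YB := fun ω hω => h𝓔 Set.subset_union_left hω
  have hWB : YW ⊆ YB := fun ω hω =>
    h𝓔 (Set.union_subset_union Set.subset_union_left le_rfl) hω
  have hKW : YK ∩ W = YW ∩ W := by
    ext ω
    simp only [YK, YW, W, Set.mem_inter_iff, Set.mem_setOf_eq]
    constructor
    · rintro ⟨h, hc⟩
      refine ⟨?_, hc⟩
      rw [← cluster_eq_of_conn hc]; exact h
    · rintro ⟨h, hc⟩
      refine ⟨?_, hc⟩
      rw [← cluster_eq_of_conn hc] at h; exact h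
  have hWBW : YW ∩ W = YB ∩ W := by
    ext ω
    simp only [YW, YB, W, Set.mem_inter_iff, Set.mem_setOf_eq]
    constructor
    · rintro ⟨h, hc⟩
      refine ⟨?_, hc⟩
      rw [cluster_eq_of_conn hc, Set.union_assoc, Set.union_self]; exact h
    · rintro ⟨h, hc⟩
      refine ⟨?_, hc⟩
      rw [cluster_eq_of_conn hc, Set.union_assoc, Set.union_self] at h; exact h
  -- the shift `P_{p[f₁,f₂↦0]}(S) = P_p({ω ∣ ω⁻ ∈ S})`
  have shift : ∀ S : Set (Config E), prob (Function.update (Function.update p f₁ 0) f₂ 0) S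
      = prob p {ω | Function.update (Function.update ω f₁ false) f₂ false ∈ S} := by
    intro S
    rw [prob_update_zero_eq_shift, prob_update_zero_eq_shift]
    rfl
  have hp' : IsProbVec (Function.update (Function.update p f₁ 0) f₂ 0) :=
    (hp.update f₁ le_rfl zero_le_one).update f₂ le_rfl zero_le_one
  -- lemma (P1) for the marks `(w, a₃, o)` in `G − a₁`, middle vertex `a₃`
  have hP1 : prob p (Aᶜ ∩ W) * prob p (A ∩ Wᶜ) ≤ prob p (A ∩ W) * prob p (Aᶜ ∩ Wᶜ ∩ Γᶜ) := by
    have h := partitionThree_lattice hp' ends w a₃ o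
    rw [shift, shift, shift, shift] at h
    have e1 : {ω : Config E | Function.update (Function.update ω f₁ false) f₂ false ∈ partABc ends w a₃ o}
        = Aᶜ ∩ W := by
      ext ω
      simp only [partABc, A, W, Set.mem_setOf_eq, Set.mem_inter_iff, Set.mem_compl_iff, mem_connEvent]
      constructor
      · rintro ⟨h1, h2⟩; exact ⟨fun h => h2 (conn_trans h1 h), conn_symm h1⟩
      · rintro ⟨h2, h1⟩; exact ⟨conn_symm h1, fun h => h2 (conn_trans h1 h)⟩
    have e2 : {ω : Config E | Function.update (Function.update ω f₁ false) f₂ false ∈ partBCa ends w a₃ o}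
        = A ∩ Wᶜ := by
      ext ω
      simp only [partBCa, A, W, Set.mem_setOf_eq, Set.mem_inter_iff, Set.mem_compl_iff, mem_connEvent]
      constructor
      · rintro ⟨h1, h2⟩; exact ⟨h1, fun h => h2 (conn_symm h)⟩
      · rintro ⟨h1, h2⟩; exact ⟨h1, fun h => h2 (conn_symm h)⟩
    have e3 : {ω : Config E | Function.update (Function.update ω f₁ false) f₂ false ∈ partAll ends w a₃ o}
        = A ∩ W := by
      ext ω
      simp only [partAll, A, W, Set.mem_setOf_eq, Set.mem_inter_iff, mem_connEvent]
      constructor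
      · rintro ⟨h1, h2⟩; exact ⟨h2, conn_symm h1⟩
      · rintro ⟨h2, h1⟩; exact ⟨conn_symm h1, h2⟩
    have e4 : {ω : Config E | Function.update (Function.update ω f₁ false) f₂ false ∈ partApart ends w a₃ o}
        = Aᶜ ∩ Wᶜ ∩ Γᶜ := by
      ext ω
      simp only [partApart, A, W, Γ, Set.mem_setOf_eq, Set.mem_inter_iff, Set.mem_compl_iff,
        mem_connEvent]
      constructor
      · rintro ⟨⟨h1, h2⟩, h3⟩; exact ⟨⟨h3, fun h => h1 (conn_symm h)⟩, h2⟩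
      · rintro ⟨⟨h3, h1⟩, h2⟩; exact ⟨⟨fun h => h1 (conn_symm h), h2⟩, h3⟩
    rw [e1, e2, e3, e4] at h
    exact h
  -- the inductive hypothesis in the abstract form
  have hZC : 0 ≤ prob p (Wᶜ ∩ Γᶜ ∩ Aᶜ) * (prob p (YW ∩ (W ∩ Γ)) - prob p YW * prob p (W ∩ Γ))
      - prob p (Wᶜ ∩ Γᶜ ∩ A) * (prob p (YW ∩ (W ∩ Γᶜ)) - prob p YW * prob p (W ∩ Γᶜ)) := by
    simp only [shift] at hZ
    have s1 : {ω : Config E | Function.update (Function.update ω f₁ false) f₂ false ∈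
        (connEvent ends a₃ w)ᶜ ∩ (connEvent ends w o)ᶜ ∩ (connEvent ends a₃ o)ᶜ} = Wᶜ ∩ Γᶜ ∩ Aᶜ := by
      ext ω; simp only [A, W, Γ, Set.mem_setOf_eq, Set.mem_inter_iff, Set.mem_compl_iff, mem_connEvent]
    have s2 : {ω : Config E | Function.update (Function.update ω f₁ false) f₂ false ∈
        clusterInEvent ends w {S | insert a₁ S ∈ 𝓔} ∩ (connEvent ends a₃ w ∩ connEvent ends w o)}
        = YW ∩ (W ∩ Γ) := by
      ext ω
      simp only [YW, W, Γ, Set.mem_setOf_eq, Set.mem_inter_iff, mem_connEvent, mem_clusterInEvent,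
        Set.insert_eq]
    have s3 : {ω : Config E | Function.update (Function.update ω f₁ false) f₂ false ∈
        clusterInEvent ends w {S | insert a₁ S ∈ 𝓔}} = YW := by
      ext ω
      simp only [YW, Set.mem_setOf_eq, mem_clusterInEvent, Set.insert_eq]
    have s4 : {ω : Config E | Function.update (Function.update ω f₁ false) f₂ false ∈
        connEvent ends a₃ w ∩ connEvent ends w o} = W ∩ Γ := by
      ext ω; simp only [W, Γ, Set.mem_setOf_eq, Set.mem_inter_iff, mem_connEvent]
    have s5 : {ω : Config E | Function.update (Function.update ω f₁ false) f₂ false ∈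
        (connEvent ends a₃ w)ᶜ ∩ (connEvent ends w o)ᶜ ∩ connEvent ends a₃ o} = Wᶜ ∩ Γᶜ ∩ A := by
      ext ω; simp only [A, W, Γ, Set.mem_setOf_eq, Set.mem_inter_iff, Set.mem_compl_iff, mem_connEvent]
    have s6 : {ω : Config E | Function.update (Function.update ω f₁ false) f₂ false ∈
        clusterInEvent ends w {S | insert a₁ S ∈ 𝓔} ∩ (connEvent ends a₃ w ∩ (connEvent ends w o)ᶜ)}
        = YW ∩ (W ∩ Γᶜ) := by
      ext ω
      simp only [YW, W, Γ, Set.mem_setOf_eq, Set.mem_inter_iff, Set.mem_compl_iff, mem_connEvent,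
        mem_clusterInEvent, Set.insert_eq]
    have s7 : {ω : Config E | Function.update (Function.update ω f₁ false) f₂ false ∈
        connEvent ends a₃ w ∩ (connEvent ends w o)ᶜ} = W ∩ Γᶜ := by
      ext ω; simp only [W, Γ, Set.mem_setOf_eq, Set.mem_inter_iff, Set.mem_compl_iff, mem_connEvent]
    rw [s1, s2, s3, s4, s5, s6, s7] at hZ
    exact hZ
  have key := zc_rootw hp hf hA hW hΓ hYK hYW hYB hAup hWup hΓup hYKup hYWup hYBup hWΓ hAW hAΓ
    hKB hWB hKW hWBW hP1 hZC
  simp only at key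
  rw [hγ, hU, he, hL]
  exact key

end GraphTheoremF

end Summit.Ventures.PercRepro2
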